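import Summits.Ventures.QEC.Thresholds.DepolarizingThresholdConverses
import Literature.InformationTheory.QuantumCodes.CSSErasureCapacityConverse
import HarnessLib

/-!
# Rate versus certified thresholds of the census families: `y₀^Z + y₀^X ≤ 1 − R`, `p₀^Z + p₀^X ≤ (1 − R)/2`,
# `p₀^depol ≤ 3(1 − R)/8` (every decoder)

Venture QEC, `Summits/Ventures/QEC/Thresholds/` (LADDER-QEC rung Q5; qec-lit-2 gen 4). HONEST FRAMING. The
rate-free ceilings of `ThresholdConverses.lean` / `DepolarizingThresholdConverses.lean` (`a + b ≤ 1` for the two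
sectors' erasure thresholds, `a + b ≤ 1/2` for code capacity, `p₀^depol ≤ 3/8`) sharpen linearly in the RATE of the
family: the packaging, over the census families `zErasureFamily`, `xErasureFamily`, `zFailureFamily`,
`xFailureFamily`, `depolarizingFailureFamily` of `CSSFamilyThresholds.lean` / `DepolarizingThresholds.lean`
(DEFINITIONALLY the families of the Literature theorems), of `Literature/…/CSSErasureCapacityConverse.lean`
(Bennett–DiVincenzo–Smolin's erasure capacity `Q = 1 − 2ε`, Delfosse–Zémor's `R ≤ 1 − 2p` for stabilizer codes,
PROVED there sector-wise for CSS codes by a cleaning/holographic count and a disjoint coupling of the two erasure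
patterns). For every family of CSS codes with `k_i ≥ 1` and `R · n_i ≤ k_i` for all `i`:

* erasures: `a + b ≤ 1 − R` for certified threshold lower bounds of `zErasureFamily` / `xErasureFamily`
  (`erasureThreshold_sum_le_one_sub_rate`), each alone `≤ 1 − R`, `y_c^Z + y_c^X ≤ 1 − R`;
* code capacity, ANY decoder families: `a + b ≤ (1 − R)/2` (`capacityThreshold_sum_le_half_sub_rate`), each alone
  `≤ (1 − R)/2`, `p_c^Z + p_c^X ≤ (1 − R)/2`, `p_c^Z ≤ (1 − R)/2`;
* depolarizing noise decoded sector-wise, ANY decoders: `p_c^depol ≤ 3(1 − R)/8`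
  (`depolarizingAccuracyThreshold_le_rate`, through the exact identity `p_c^depol = (3/2)·min(p_c^X, p_c^Z)`);
* finite size, every CSS code, every decoder pair: `k ≤ n(1 − y_Z − y_X + P^Z_{y_Z} + P^X_{y_X})` and
  `k ≤ n(1 − 2p − 2p' + 2P^Z_p[D_Z] + 2P^X_{p'}[D_X])` are the Literature theorems `CSSCode.k_le_card_mul_erasure` /
  `CSSCode.k_le_card_mul_capacity` (not restated).

For the rate-`0` families of the census (toric, planar) these say nothing new; they bind the positive-rate qLDPC
families (hypergraph products of good classical codes, quantum expander codes, two-block families at fixed rate).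
Kernel axioms only; no named fact; no `native_decide`; no new definition.

## References

* [BennettDivincenzoSmolin1997] C. H. Bennett, D. P. DiVincenzo, J. A. Smolin, PRL 78 (1997) 3217, p. 3218
  (`Q = max{0, 1 − 2ε}`; «two bits of redundancy per erased qubit are necessary and sufficient»).
* [DelfosseZemor2013] N. Delfosse, G. Zémor, QIC 13 (2013) 793, §3 eq. (capacity), §3.3, Thm. 3.5 (`R ≤ 1 − 2p`).
* [RichardsonUrbanke2008] T. Richardson, R. Urbanke, *Modern Coding Theory*, Lemma 4.78 (Erasure Decomposition).
* [DennisEtAl2002] E. Dennis, A. Kitaev, A. Landahl, J. Preskill, J. Math. Phys. 43 (2002) 4452, §4.6 (`p_c`).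
-/

noncomputable section

namespace Summit.Ventures.QEC.Thresholds

open Filter Topology Finset Matrix
open Literature.InformationTheory.QuantumCodes

section Families

variable {RX RZ Q : ℕ → Type*} [∀ i, Fintype (Q i)] [∀ i, DecidableEq (Q i)] [∀ i, Fintype (RX i)]
  [∀ i, Fintype (RZ i)]

/-- **Erasure ceilings versus rate, census form**: for a family of CSS codes with `k ≥ 1` and rate `≥ R`
(`R n_i ≤ k_i`), certified erasure threshold lower bounds `a` (for `zErasureFamily`) and `b` (for
`xErasureFamily`) satisfy `a + b ≤ 1 − R`. [cite: BennettDivincenzoSmolin1997, p. 3218 (Q = max{0, 1 − 2ε}); DelfosseZemor2013, §3 Thm. 3.5 (R ≤ 1 − 2p)] -/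
theorem erasureThreshold_sum_le_one_sub_rate (C : ∀ i, CSSCode (RX i) (RZ i) (Q i)) (hk : ∀ i, 0 < (C i).k)
    {R : ℝ} (hR : ∀ i, R * Fintype.card (Q i) ≤ (C i).k) {a b : ℝ}
    (ha : IsThresholdLowerBound (zErasureFamily C) a) (hb : IsThresholdLowerBound (xErasureFamily C) b) :
    a + b ≤ 1 - R :=
  erasure_thresholds_add_le_one_sub_rate C hk hR ha hb

/-- **`y_c^Z + y_c^X ≤ 1 − R`** for the erasure accuracy thresholds of the two sectors.
[cite: BennettDivincenzoSmolin1997, p. 3218 (Q = max{0, 1 − 2ε}); DennisEtAl2002, §4.6 (p_c)] -/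
theorem erasureAccuracyThreshold_sum_le_one_sub_rate (C : ∀ i, CSSCode (RX i) (RZ i) (Q i))
    (hk : ∀ i, 0 < (C i).k) {R : ℝ} (hR : ∀ i, R * Fintype.card (Q i) ≤ (C i).k) :
    accuracyThreshold (zErasureFamily C) + accuracyThreshold (xErasureFamily C) ≤ 1 - R :=
  erasure_accuracyThresholds_add_le_one_sub_rate C hk hR

/-- One sector: every certified `Z`-sector erasure threshold lower bound is `≤ 1 − R`.
[cite: BennettDivincenzoSmolin1997, p. 3218; DelfosseZemor2013, §3.3 (2|ℰ| ≤ rank H)] -/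
theorem erasureThreshold_le_one_sub_rate (C : ∀ i, CSSCode (RX i) (RZ i) (Q i)) (hk : ∀ i, 0 < (C i).k)
    {R : ℝ} (hR : ∀ i, R * Fintype.card (Q i) ≤ (C i).k) {a : ℝ}
    (ha : IsThresholdLowerBound (zErasureFamily C) a) : a ≤ 1 - R :=
  erasure_threshold_le_one_sub_rate C hk hR ha

/-- One sector: every certified `X`-sector erasure threshold lower bound is `≤ 1 − R`.
[cite: BennettDivincenzoSmolin1997, p. 3218; DelfosseZemor2013, §3.3 (2|ℰ| ≤ rank H)] -/
theorem xErasureThreshold_le_one_sub_rate (C : ∀ i, CSSCode (RX i) (RZ i) (Q i)) (hk : ∀ i, 0 < (C i).k)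
    {R : ℝ} (hR : ∀ i, R * Fintype.card (Q i) ≤ (C i).k) {b : ℝ}
    (hb : IsThresholdLowerBound (xErasureFamily C) b) : b ≤ 1 - R :=
  x_erasure_threshold_le_one_sub_rate C hk hR hb

/-- **Code-capacity ceilings versus rate, census form, ANY decoders**: certified threshold lower bounds `a`
(for `zFailureFamily C DZ`) and `b` (for `xFailureFamily C DX`) satisfy `a + b ≤ (1 − R)/2`.
[cite: BennettDivincenzoSmolin1997, p. 3218 (Q ≤ 1 − 2ε); RichardsonUrbanke2008, Lemma 4.78 (Erasure Decomposition Lemma)] -/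
theorem capacityThreshold_sum_le_half_sub_rate (C : ∀ i, CSSCode (RX i) (RZ i) (Q i)) (hk : ∀ i, 0 < (C i).k)
    {R : ℝ} (hR : ∀ i, R * Fintype.card (Q i) ≤ (C i).k)
    (DZ : ∀ i, Decoder (RX i → ZMod 2) (Q i → ZMod 2)) (DX : ∀ i, Decoder (RZ i → ZMod 2) (Q i → ZMod 2))
    {a b : ℝ} (ha : IsThresholdLowerBound (zFailureFamily C DZ) a)
    (hb : IsThresholdLowerBound (xFailureFamily C DX) b) : a + b ≤ (1 - R) / 2 :=
  capacity_thresholds_add_le_half_sub_rate C hk hR DZ DX ha hb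

/-- **`p_c^Z + p_c^X ≤ (1 − R)/2`**, ANY decoder families. [cite: BennettDivincenzoSmolin1997, p. 3218 (Q ≤ 1 − 2ε); DennisEtAl2002, §4.6 (p_c)] -/
theorem capacityAccuracyThreshold_sum_le_half_sub_rate (C : ∀ i, CSSCode (RX i) (RZ i) (Q i))
    (hk : ∀ i, 0 < (C i).k) {R : ℝ} (hR : ∀ i, R * Fintype.card (Q i) ≤ (C i).k)
    (DZ : ∀ i, Decoder (RX i → ZMod 2) (Q i → ZMod 2)) (DX : ∀ i, Decoder (RZ i → ZMod 2) (Q i → ZMod 2)) :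
    accuracyThreshold (zFailureFamily C DZ) + accuracyThreshold (xFailureFamily C DX) ≤ (1 - R) / 2 :=
  capacity_accuracyThresholds_add_le_half_sub_rate C hk hR DZ DX

/-- One sector, any decoder family: every certified `Z`-sector code-capacity threshold lower bound is
`≤ (1 − R)/2`. [cite: BennettDivincenzoSmolin1997, p. 3218 (Q ≤ 1 − 2ε); RichardsonUrbanke2008, Lemma 4.78] -/
theorem capacityThreshold_le_half_sub_rate (C : ∀ i, CSSCode (RX i) (RZ i) (Q i)) (hk : ∀ i, 0 < (C i).k)
    {R : ℝ} (hR : ∀ i, R * Fintype.card (Q i) ≤ (C i).k)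
    (DZ : ∀ i, Decoder (RX i → ZMod 2) (Q i → ZMod 2)) {a : ℝ}
    (ha : IsThresholdLowerBound (zFailureFamily C DZ) a) : a ≤ (1 - R) / 2 := by
  have h := capacity_thresholds_add_le_half_sub_rate C hk hR DZ (fun i => fun _ => 0) ha
    (isThresholdLowerBound_of_nonpos (P := xFailureFamily C fun i => fun _ => 0) le_rfl)
  linarith

/-- One sector, any decoder family: every certified `X`-sector code-capacity threshold lower bound is
`≤ (1 − R)/2`. [cite: BennettDivincenzoSmolin1997, p. 3218 (Q ≤ 1 − 2ε); RichardsonUrbanke2008, Lemma 4.78] -/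
theorem xCapacityThreshold_le_half_sub_rate (C : ∀ i, CSSCode (RX i) (RZ i) (Q i)) (hk : ∀ i, 0 < (C i).k)
    {R : ℝ} (hR : ∀ i, R * Fintype.card (Q i) ≤ (C i).k)
    (DX : ∀ i, Decoder (RZ i → ZMod 2) (Q i → ZMod 2)) {b : ℝ}
    (hb : IsThresholdLowerBound (xFailureFamily C DX) b) : b ≤ (1 - R) / 2 := by
  have h := capacity_thresholds_add_le_half_sub_rate C hk hR (fun i => fun _ => 0) DX
    (isThresholdLowerBound_of_nonpos (P := zFailureFamily C fun i => fun _ => 0) le_rfl) hb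
  linarith

/-- **`p_c^Z ≤ (1 − R)/2`** for every decoder family. [cite: BennettDivincenzoSmolin1997, p. 3218 (Q ≤ 1 − 2ε); DennisEtAl2002, §4.6 (p_c)] -/
theorem capacityAccuracyThreshold_le_half_sub_rate (C : ∀ i, CSSCode (RX i) (RZ i) (Q i))
    (hk : ∀ i, 0 < (C i).k) {R : ℝ} (hR : ∀ i, R * Fintype.card (Q i) ≤ (C i).k)
    (DZ : ∀ i, Decoder (RX i → ZMod 2) (Q i → ZMod 2)) :
    accuracyThreshold (zFailureFamily C DZ) ≤ (1 - R) / 2 :=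
  capacity_accuracyThreshold_le_half_sub_rate C hk hR DZ

/-- **`p_c^X ≤ (1 − R)/2`** for every decoder family. [cite: BennettDivincenzoSmolin1997, p. 3218 (Q ≤ 1 − 2ε); DennisEtAl2002, §4.6 (p_c)] -/
theorem xCapacityAccuracyThreshold_le_half_sub_rate (C : ∀ i, CSSCode (RX i) (RZ i) (Q i))
    (hk : ∀ i, 0 < (C i).k) {R : ℝ} (hR : ∀ i, R * Fintype.card (Q i) ≤ (C i).k)
    (DX : ∀ i, Decoder (RZ i → ZMod 2) (Q i → ZMod 2)) :
    accuracyThreshold (xFailureFamily C DX) ≤ (1 - R) / 2 :=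
  xCapacityThreshold_le_half_sub_rate C hk hR DX (isThresholdLowerBound_accuracyThreshold _)

/-- **Depolarizing noise, sector-wise decoding, ANY decoders: `p_c^depol ≤ 3(1 − R)/8`** — through the exact
identity `p_c^depol = (3/2)·min(p_c^X, p_c^Z)` and `p_c^Z + p_c^X ≤ (1 − R)/2`.
[cite: BennettDivincenzoSmolin1997, p. 3218 (Q ≤ 1 − 2ε); DennisEtAl2002, §4.1 (depolarizing channel) and §4.6 (p_c)] -/
theorem depolarizingAccuracyThreshold_le_rate (C : ∀ i, CSSCode (RX i) (RZ i) (Q i)) (hk : ∀ i, 0 < (C i).k)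
    {R : ℝ} (hR : ∀ i, R * Fintype.card (Q i) ≤ (C i).k)
    (DX : ∀ i, Decoder (RZ i → ZMod 2) (Q i → ZMod 2)) (DZ : ∀ i, Decoder (RX i → ZMod 2) (Q i → ZMod 2)) :
    accuracyThreshold (depolarizingFailureFamily C DX DZ) ≤ 3 * (1 - R) / 8 := by
  rw [depolarizingAccuracyThreshold_eq C hk DX DZ]
  have hsum : accuracyThreshold (zFailureFamily C DZ) + accuracyThreshold (xFailureFamily C DX) ≤ (1 - R) / 2 :=
    capacity_accuracyThresholds_add_le_half_sub_rate C hk hR DZ DX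
  have h1 := min_le_left (accuracyThreshold (xFailureFamily C DX)) (accuracyThreshold (zFailureFamily C DZ))
  have h2 := min_le_right (accuracyThreshold (xFailureFamily C DX)) (accuracyThreshold (zFailureFamily C DZ))
  linarith

/-- Threshold-lower-bound form: every certified depolarizing threshold lower bound `a` of a family with `k ≥ 1` and
rate `≥ R` (sector-wise decoding, any decoders) is `≤ 3(1 − R)/8`. [cite: BennettDivincenzoSmolin1997, p. 3218 (Q ≤ 1 − 2ε); DennisEtAl2002, §4.1 and §4.6] -/
theorem depolarizingThreshold_le_rate (C : ∀ i, CSSCode (RX i) (RZ i) (Q i)) (hk : ∀ i, 0 < (C i).k)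
    {R : ℝ} (hR : ∀ i, R * Fintype.card (Q i) ≤ (C i).k)
    (DX : ∀ i, Decoder (RZ i → ZMod 2) (Q i → ZMod 2)) (DZ : ∀ i, Decoder (RX i → ZMod 2) (Q i → ZMod 2))
    {a : ℝ} (ha : IsThresholdLowerBound (depolarizingFailureFamily C DX DZ) a) : a ≤ 3 * (1 - R) / 8 := by
  have h38 : a ≤ 3 / 8 := depolarizingThreshold_le_three_eighths C hk DX DZ ha
  have h := le_accuracyThreshold ha (by linarith)
  exact h.trans (depolarizingAccuracyThreshold_le_rate C hk hR DX DZ)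

end Families

end Summit.Ventures.QEC.Thresholds
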